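import Mathlib
import HarnessLib

/-!
# Route LiouvilleSarnak — cruxes `LiouvilleCutRank` (stmt-14775) / `DigitalBilinearLiouville` (stmt-14774):
# the WALSH-SIDE cut matrix is a conjugate of the cut matrix (same rank, singular values scaled by `2^n`)

The card of both cruxes cites Bourgain's Möbius–Walsh bounds [Bourgain2013MoebiusWalsh]: the Walsh–Fourier
coefficients `Σ_{N<4^n} λ(N+1) W_ζ(N)`, `W_ζ(N) = (-1)^{Σ_k ζ_k N_k}`, are uniformly small.  Split the frequency bits
`ζ` by the same cut `π` into row frequencies `ξ` and column frequencies `η`; the resulting `2^n × 2^n` WALSH-SIDE CUT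
MATRIX `Ĉ_π[ξ, η] = Σ_{r,c} (-1)^{ξ·r} (-1)^{η·c} M_π[r,c]` is `H M_π Hᵀ` with the Sylvester–Hadamard matrix
`H[ξ, r] = (-1)^{ξ·r}` on `{0,1}^n`, and `H Hᵀ = 2^n · 1`.  Hence (this file):

* `hadamard_mul_transpose` — `H Hᵀ = 2^n • 1` (orthogonality of the Walsh characters of `(ℤ/2)^n`);
* ★ `rank_walshSide_eq` — `rank Ĉ = rank M` for EVERY `2^n × 2^n` matrix `M` indexed by `{0,1}^n` (so for every cut
  matrix of `λ`): `LiouvilleCutRank` is verbatim the statement that the Walsh-side cut matrices of `λ` have unbounded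
  rank; likewise (`Ĉ/2^n` is unitarily conjugate to `M`) `DigitalBilinearLiouville` says `‖Ĉ_π‖_op = o(4^n)` while each
  ENTRY of `Ĉ_π` is a Walsh sum of size `≤ 4^n` — Bourgain's entrywise saving `4^n · 2^{-m^c}` is far from the
  square-root saving an operator-norm / rank statement would need, so the Walsh literature does not shortcut either crux.

Honest framing: linear-algebra bookkeeping (a change of basis), no case of either crux; `LiouvilleCutRank`,
`DigitalBilinearLiouville`, `AlgebraicSarnak` stay OPEN; nothing bears on `VP ≠ VNP`.  No definitions (the Hadamard
matrix is the explicit term `Matrix.of fun ξ r => (-1)^{#{i | ξ i ∧ r i}}`); imports `Mathlib` only.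
-/

set_option linter.dupNamespace false

noncomputable section

namespace Summit.ValiantsHypothesis.ValiantsHypothesis.Theorems.LiouvilleSarnakLiouvilleCutRank.WalshDual

open Finset Matrix

/-! ### §1 The Sylvester–Hadamard matrix on `{0,1}^n` -/

/-- One Walsh factor: `Σ_{b ∈ {0,1}} (-1)^{[x ∧ b]} (-1)^{[y ∧ b]}` is `2` if `x = y` and `0` otherwise. [folklore] -/
theorem sum_bool_sign_mul (x y : Bool) :
    (∑ b : Bool, ((-1 : ℂ) ^ (if (x && b) then 1 else 0 : ℕ)) * ((-1 : ℂ) ^ (if (y && b) then 1 else 0 : ℕ))) =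
      if x = y then 2 else 0 := by
  rw [Fintype.sum_bool]
  cases x <;> cases y <;> norm_num

/-- The Hadamard entry as a product over coordinates: `(-1)^{#{i | ξ i ∧ r i}} = ∏_i (-1)^{[ξ i ∧ r i]}`. [folklore] -/
theorem neg_one_pow_card_eq_prod {n : ℕ} (ξ r : Fin n → Bool) :
    ((-1 : ℂ) ^ (Finset.univ.filter fun i : Fin n => (ξ i && r i) = true).card) =
      ∏ i : Fin n, (-1 : ℂ) ^ (if (ξ i && r i) then 1 else 0 : ℕ) := by
  rw [Finset.card_filter, ← Finset.prod_pow_eq_pow_sum]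

/-- **Orthogonality of Walsh characters** (sum form): `Σ_r (-1)^{ξ·r} (-1)^{η·r} = 2^n [ξ = η]`. [folklore] -/
theorem walsh_orthogonality {n : ℕ} (ξ η : Fin n → Bool) :
    (∑ r : Fin n → Bool, ((-1 : ℂ) ^ (Finset.univ.filter fun i : Fin n => (ξ i && r i) = true).card) *
        ((-1 : ℂ) ^ (Finset.univ.filter fun i : Fin n => (η i && r i) = true).card)) =
      if ξ = η then (2 : ℂ) ^ n else 0 := by
  classical
  set g : Fin n → Bool → ℂ := fun i b =>
    ((-1 : ℂ) ^ (if (ξ i && b) then 1 else 0 : ℕ)) * ((-1 : ℂ) ^ (if (η i && b) then 1 else 0 : ℕ)) with hg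
  have hterm : ∀ r : Fin n → Bool,
      ((-1 : ℂ) ^ (Finset.univ.filter fun i : Fin n => (ξ i && r i) = true).card) *
        ((-1 : ℂ) ^ (Finset.univ.filter fun i : Fin n => (η i && r i) = true).card) = ∏ i : Fin n, g i (r i) := by
    intro r
    rw [neg_one_pow_card_eq_prod, neg_one_pow_card_eq_prod, ← Finset.prod_mul_distrib]
  simp_rw [hterm]
  rw [← Fintype.prod_sum g]
  have hfac : ∀ i : Fin n, (∑ b : Bool, g i b) = if ξ i = η i then 2 else 0 := fun i => by
    rw [hg]; exact sum_bool_sign_mul (ξ i) (η i)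
  simp_rw [hfac]
  by_cases h : ξ = η
  · subst h
    simp
  · have hne : ∃ i, ξ i ≠ η i := by
      by_contra hall; push Not at hall; exact h (funext hall)
    obtain ⟨i, hi⟩ := hne
    rw [if_neg h]
    exact Finset.prod_eq_zero (Finset.mem_univ i) (if_neg hi)

/-- **Orthogonality of Walsh characters** (matrix form): with `H[ξ, r] = (-1)^{#{i | ξ i ∧ r i}}` on `{0,1}^n`,
`H Hᵀ = 2^n • 1`. [folklore] -/
theorem hadamard_mul_transpose (n : ℕ) :
    (Matrix.of fun ξ r : Fin n → Bool =>
        ((-1 : ℂ) ^ (Finset.univ.filter fun i : Fin n => (ξ i && r i) = true).card)) *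
      (Matrix.of fun ξ r : Fin n → Bool =>
        ((-1 : ℂ) ^ (Finset.univ.filter fun i : Fin n => (ξ i && r i) = true).card)).transpose =
      (2 : ℂ) ^ n • (1 : Matrix (Fin n → Bool) (Fin n → Bool) ℂ) := by
  classical
  ext ξ η
  rw [Matrix.mul_apply, Matrix.smul_apply, Matrix.one_apply, smul_eq_mul]
  simp only [Matrix.transpose_apply, Matrix.of_apply]
  rw [walsh_orthogonality]
  split_ifs <;> simp

/-! ### §2 The Walsh-side matrix has the same rank -/

/-- ★ **Walsh duality for cut matrices.**  For every `2^n × 2^n` complex matrix `M` indexed by `{0,1}^n × {0,1}^n`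
(e.g. a cut matrix `M_π` of `λ`), the Walsh-side matrix `Ĉ[ξ,η] = Σ_{r,c} (-1)^{ξ·r} (-1)^{η·c} M[r,c]` (`= H M Hᵀ`)
has the same rank as `M`, since `H Hᵀ = 2^n • 1` makes `H` invertible. [folklore] -/
theorem rank_walshSide_eq (n : ℕ) (M : Matrix (Fin n → Bool) (Fin n → Bool) ℂ) :
    (Matrix.of fun ξ η : Fin n → Bool => ∑ r : Fin n → Bool, ∑ c : Fin n → Bool,
        ((-1 : ℂ) ^ (Finset.univ.filter fun i : Fin n => (ξ i && r i) = true).card) *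
          ((-1 : ℂ) ^ (Finset.univ.filter fun i : Fin n => (η i && c i) = true).card) * M r c).rank =
      M.rank := by
  classical
  set H : Matrix (Fin n → Bool) (Fin n → Bool) ℂ := Matrix.of fun ξ r : Fin n → Bool =>
      ((-1 : ℂ) ^ (Finset.univ.filter fun i : Fin n => (ξ i && r i) = true).card) with hH
  have hHH : H * H.transpose = (2 : ℂ) ^ n • (1 : Matrix (Fin n → Bool) (Fin n → Bool) ℂ) :=
    hadamard_mul_transpose n
  -- `H` is invertible
  have hdet : IsUnit H.det := by
    have h1 : H.det * H.transpose.det = ((2 : ℂ) ^ n) ^ Fintype.card (Fin n → Bool) := by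
      rw [← Matrix.det_mul, hHH, Matrix.det_smul, Matrix.det_one, mul_one]
    have h2 : H.det * H.transpose.det ≠ 0 := by rw [h1]; exact pow_ne_zero _ (pow_ne_zero _ two_ne_zero)
    exact isUnit_iff_ne_zero.mpr (left_ne_zero_of_mul h2)
  have hdetT : IsUnit H.transpose.det := by rwa [Matrix.det_transpose]
  -- the Walsh-side matrix is `H * M * Hᵀ`
  have hC : (Matrix.of fun ξ η : Fin n → Bool => ∑ r : Fin n → Bool, ∑ c : Fin n → Bool,
        ((-1 : ℂ) ^ (Finset.univ.filter fun i : Fin n => (ξ i && r i) = true).card) *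
          ((-1 : ℂ) ^ (Finset.univ.filter fun i : Fin n => (η i && c i) = true).card) * M r c) =
      H * M * H.transpose := by
    ext ξ η
    simp only [Matrix.of_apply, Matrix.mul_apply, Matrix.transpose_apply, hH, Finset.sum_mul]
    rw [Finset.sum_comm]
    refine Finset.sum_congr rfl fun c _ => Finset.sum_congr rfl fun r _ => ?_
    ring
  rw [hC, Matrix.rank_mul_eq_left_of_isUnit_det _ _ hdetT, Matrix.rank_mul_eq_right_of_isUnit_det _ _ hdet]

end Summit.ValiantsHypothesis.ValiantsHypothesis.Theorems.LiouvilleSarnakLiouvilleCutRank.WalshDual
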